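import Literature.CategoryTheory.Preadditive.EvansCancellation
import Literature.CategoryTheory.Preadditive.KrullSchmidtMultiplicity
import Literature.RingTheory.Idempotents.SemiperfectCornersQuotients
import HarnessLib

/-!
# Krull–Schmidt objects: `End X` is semiperfect iff `X` is a finite sum of objects with local endomorphism rings
# (Krause, Cor. 4.4, in full, object-wise); consequences for cancellation and multiplicities

Topic `Literature/CategoryTheory/Preadditive`, namespace `Literature.CategoryTheory.KrullSchmidt`; sequel of `KrullSchmidtSemiperfect`
(seat p39 g37-#2: Krause Cor. 4.4 object-wise in the form «`X ≅ ⨁` local-`End` objects ⟺ `1 ∈ End X` is a sum of orthogonal idempotents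
with local corners», and `IsSemiperfectRing (End X) ⟹` such a decomposition), `EvansCancellation` (g37-#4), `KrullSchmidtMultiplicity`
(g37-#6), `KrullSchmidtUniqueness` (p39 g36-#15: the projection idempotents of `X ≅ ⨁ Xⱼ`, corners `≃+* End Xⱼ`), and of the ring theory
`SemiperfectOfLocalIdempotents` (g37-#8: **Lam (23.6) ⟸**) and `SemiperfectCornersQuotients` (g37-#9: **AF 27.7**).

With Lam (23.6) ⟸ now in the tree the one-sided statements of g37-#2 close up: **`End X` is semiperfect iff `X` is a finite biproduct
of objects with local endomorphism rings** — Krause [Krause2015KS, Cor. 4.4] «An additive category is a Krull-Schmidt category if and only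
if it has split idempotents and the endomorphism ring of every object is semi-perfect», object by object (⟸ needs no idempotent
completeness).  Consequently every result of g37-#2∕#4∕#6 stated under `[IsSemiperfectRing (End X)]` holds for KRULL–SCHMIDT OBJECTS —
objects given with ONE decomposition into local-`End` summands: indecomposable summands are then automatically local (Lam (23.5)),
decompositions into indecomposables are unique (Krause Thm. 4.2 without the locality hypothesis on the second decomposition), such objects
CANCEL from biproducts (Evans) and from powers.  Also: `End (⨁ Xⱼ)` is semiperfect iff every `End Xⱼ` is (AF 27.7 through the
projection idempotents), in particular `End (Y ⊞ Z)`.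

## What is formalised

* §1 `isSemiperfectRing_end_of_iso_biproduct_isLocalRing_end` (Krause 4.4 ⟹ object-wise: a finite sum of local-`End` objects has
  semiperfect `End`), **`isSemiperfectRing_end_iff_exists_iso_biproduct_isLocalRing_end`** (Krause Cor. 4.4 object-wise, in full;
  idempotent-complete `C`), `…_iff_exists_iso_biproduct_indecomposable`.
* §2 **`isSemiperfectRing_end_iff_of_iso_biproduct`**: `End X` semiperfect iff all `End Xⱼ` are, for `X ≅ ⨁ Xⱼ` (AF 27.7);
  `isSemiperfectRing_end_biproduct`, `isSemiperfectRing_end_biprod(_iff)`.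
* §3 Krull–Schmidt objects: `isLocalRing_end_of_indecomposable_of_iso_biproduct_isLocalRing_end` (indecomposable summands of a
  Krull–Schmidt object are local), **`krullRemakSchmidt_of_iso_biproduct_isLocalRing_end`** (uniqueness among ALL decompositions into
  indecomposables), **`nonempty_iso_of_biprod_iso_biprod_of_iso_biproduct_isLocalRing_end`** (Krull–Schmidt objects cancel),
  **`nonempty_iso_of_biproduct_const_iso_of_iso_biproduct_isLocalRing_end`** (power cancellation), `nonempty_iso_iff_forall_natCard_eq'`.

Theorems only, 0 `sorry`, no definition, no named fact (net debt 0, D-0026); no instance, no notation.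

## Mathlib / Literature search

Mathlib: `biprod.inl_fst`, `biprod.inr_snd`, `biprod.total`, `Iso.refl`; no Krull–Schmidt categories.  Literature: `rg "isSemiperfectRing_end"
lean/Literature` → g37-#2 (`_of_split ∕ _of_iso ∕ _of_iso_biproduct` = passing TO summands only), g37-#3, g37-#5; the converse directions here
are new in the tree.

## References

* H. Krause, *Krull–Schmidt categories and projective covers*, Expo. Math. 33 (2015) 535–549: Prop. 4.1, Thm. 4.2, Cor. 4.3, Cor. 4.4.
  [Krause2015KS]
* T. Y. Lam, *A First Course in Noncommutative Rings*, 2nd ed. (2001): §23 Prop. (23.5), Thm. (23.6), Thm. (23.8). [Lam2001FirstCourse]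
* F. W. Anderson, K. R. Fuller, *Rings and Categories of Modules*, 2nd ed. (1992): Cor. 27.7. [AndersonFuller1992]
* A. Shah, *Krull–Remak–Schmidt decompositions in Hom-finite additive categories*, Expo. Math. 41 (2023): Thm. 6.1. [Shah2023KRS]

## Provenance

Lane `lit-hodgefound` (summit `HodgeConjecture`, Track 2 foundations library), seat `lit-hodgefound-p39` (literature-prover, generation 37,
row g37-#10); Krause materialised as paper-arxiv-1410.2822 (p0008).
-/

open CategoryTheory CategoryTheory.Limits

namespace Literature.CategoryTheory.KrullSchmidt

open Literature.RingTheory.Idempotents (IsSemiperfectRing)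

universe v u

variable {C : Type u} [Category.{v} C] [Preadditive C]

/-! ## §1 Krause Cor. 4.4 object-wise, in full -/

section KrauseFourFour

variable [HasFiniteBiproducts C] {X : C}

/-- **KRAUSE COR. 4.4 ⟹, OBJECT-WISE: a finite biproduct of objects with local endomorphism rings has SEMIPERFECT endomorphism ring**
(the projection idempotents `eⱼ = πⱼιⱼ` are a complete orthogonal family of `End X` with corners `≅ End Xⱼ` local; Lam (23.6) ⟸).  No
idempotent completeness is needed. [cite: Krause2015KS, Cor. 4.4, Prop. 4.1 (1)⟹(2)] [cite: Lam2001FirstCourse, §23 Thm. (23.6), Thm. (23.8)] -/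
theorem isSemiperfectRing_end_of_iso_biproduct_isLocalRing_end {ι : Type} [Fintype ι] {Xs : ι → C} (i : X ≅ ⨁ Xs)
    (h : ∀ j, IsLocalRing (End (Xs j))) : IsSemiperfectRing (End X) :=
  Literature.RingTheory.Idempotents.isSemiperfectRing_of_completeOrthogonalIdempotents_isLocalRing_corner
    (completeOrthogonalIdempotents_of_iso_biproduct i) fun j => (isLocalRing_corner_iff_of_iso_biproduct i j).2 (h j)

/-- A finite biproduct of objects with local endomorphism rings has semiperfect endomorphism ring. [cite: Krause2015KS, Cor. 4.4]
[cite: Lam2001FirstCourse, §23 Thm. (23.6)] -/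
theorem isSemiperfectRing_end_biproduct_of_isLocalRing_end {ι : Type} [Fintype ι] (Xs : ι → C) [h : ∀ j, IsLocalRing (End (Xs j))] :
    IsSemiperfectRing (End (⨁ Xs)) :=
  isSemiperfectRing_end_of_iso_biproduct_isLocalRing_end (Iso.refl _) h

variable (X) in
/-- **KRAUSE COROLLARY 4.4, OBJECT-WISE, IN FULL: in an idempotent-complete preadditive category with finite biproducts, `End X` is
semiperfect iff `X` is a finite biproduct of objects with local endomorphism rings** («An additive category is a Krull-Schmidt category
if and only if it has split idempotents and the endomorphism ring of every object is semi-perfect»). [cite: Krause2015KS, Cor. 4.4,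
Prop. 4.1] [cite: Lam2001FirstCourse, §23 Thm. (23.6), Thm. (23.8)] -/
theorem isSemiperfectRing_end_iff_exists_iso_biproduct_isLocalRing_end [IsIdempotentComplete C] :
    IsSemiperfectRing (End X) ↔ ∃ (n : ℕ) (Y : Fin n → C), Nonempty (X ≅ ⨁ Y) ∧ ∀ j, IsLocalRing (End (Y j)) :=
  ⟨fun _ => exists_iso_biproduct_isLocalRing_end_of_isSemiperfectRing X, fun ⟨_, _, ⟨i⟩, h⟩ =>
    isSemiperfectRing_end_of_iso_biproduct_isLocalRing_end i h⟩

variable (X) in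
/-- The same with indecomposable (and local) summands: **`End X` is semiperfect iff `X` has a Krull–Remak–Schmidt decomposition.**
[cite: Krause2015KS, Cor. 4.4, §4] [cite: Shah2023KRS, Def. 4.6, Thm. 6.1] -/
theorem isSemiperfectRing_end_iff_exists_iso_biproduct_indecomposable [HasBinaryBiproducts C] [IsIdempotentComplete C] :
    IsSemiperfectRing (End X) ↔
      ∃ (n : ℕ) (Y : Fin n → C), Nonempty (X ≅ ⨁ Y) ∧ ∀ j, Indecomposable (Y j) ∧ IsLocalRing (End (Y j)) :=
  ⟨fun _ => exists_iso_biproduct_indecomposable_of_isSemiperfectRing X, fun ⟨_, _, ⟨i⟩, h⟩ =>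
    isSemiperfectRing_end_of_iso_biproduct_isLocalRing_end i fun j => (h j).2⟩

end KrauseFourFour

/-! ## §2 `End (⨁ Xⱼ)` is semiperfect iff every `End Xⱼ` is (AF 27.7 through the projections) -/

section Sums

variable [HasFiniteBiproducts C] {X : C}

/-- **If `X ≅ ⨁ⱼ Xⱼ` and every `End Xⱼ` is semiperfect then `End X` is semiperfect** (Anderson–Fuller 27.7 ⟸ for the projection
idempotents, whose corners are `≅ End Xⱼ`). [cite: AndersonFuller1992, Cor. 27.7] [cite: Krause2015KS, Cor. 4.4] -/
theorem isSemiperfectRing_end_of_iso_biproduct_isSemiperfectRing_end {ι : Type} [Fintype ι] {Xs : ι → C} (i : X ≅ ⨁ Xs)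
    (h : ∀ j, IsSemiperfectRing (End (Xs j))) : IsSemiperfectRing (End X) :=
  Literature.RingTheory.Idempotents.isSemiperfectRing_of_completeOrthogonalIdempotents_isSemiperfectRing_corner
    (completeOrthogonalIdempotents_of_iso_biproduct i) fun j => by
      obtain ⟨Φ⟩ := nonempty_end_ringEquiv_corner (biproduct.ι Xs j ≫ i.inv) (i.hom ≫ biproduct.π Xs j)
        (biproductIncl_comp_proj i j) rfl ((completeOrthogonalIdempotents_of_iso_biproduct i).idem j)
      haveI := h j
      exact Literature.RingTheory.Idempotents.isSemiperfectRing_of_ringEquiv Φ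

/-- **`End X` is semiperfect iff every `End Xⱼ` is, for a finite biproduct decomposition `X ≅ ⨁ⱼ Xⱼ`** (⟹: summands are retracts,
g37-#2). [cite: AndersonFuller1992, Cor. 27.7] [cite: Krause2015KS, Cor. 4.4] -/
theorem isSemiperfectRing_end_iff_of_iso_biproduct {ι : Type} [Fintype ι] {Xs : ι → C} (i : X ≅ ⨁ Xs) :
    IsSemiperfectRing (End X) ↔ ∀ j, IsSemiperfectRing (End (Xs j)) :=
  ⟨fun _ j => isSemiperfectRing_end_of_iso_biproduct i j, isSemiperfectRing_end_of_iso_biproduct_isSemiperfectRing_end i⟩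

/-- A finite biproduct of objects with semiperfect endomorphism rings has semiperfect endomorphism ring. [cite: AndersonFuller1992,
Cor. 27.7] [cite: Lam2001FirstCourse, §23 (23.4)] -/
theorem isSemiperfectRing_end_biproduct {ι : Type} [Fintype ι] (Xs : ι → C) [h : ∀ j, IsSemiperfectRing (End (Xs j))] :
    IsSemiperfectRing (End (⨁ Xs)) :=
  isSemiperfectRing_end_of_iso_biproduct_isSemiperfectRing_end (Iso.refl _) h

omit [HasFiniteBiproducts C] in
/-- **`End (Y ⊞ Z)` is semiperfect when `End Y` and `End Z` are** (AF 27.7 for `1 = e + (1 − e)`, `e = fst ≫ inl`, whose corners are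
`≅ End Y`, `≅ End Z`). [cite: AndersonFuller1992, Cor. 27.7] [cite: Lam2001FirstCourse, §23 (23.4)] -/
theorem isSemiperfectRing_end_biprod [HasBinaryBiproducts C] (Y Z : C) [IsSemiperfectRing (End Y)] [IsSemiperfectRing (End Z)] :
    IsSemiperfectRing (End (Y ⊞ Z)) := by
  have he : IsIdempotentElem (End.of (biprod.fst ≫ biprod.inl : Y ⊞ Z ⟶ Y ⊞ Z)) :=
    isIdempotentElem_of_split biprod.inl biprod.fst biprod.inl_fst
  have htot : End.of (biprod.fst ≫ biprod.inl : Y ⊞ Z ⟶ Y ⊞ Z) + End.of (biprod.snd ≫ biprod.inr) = 1 := biprod.total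
  have he' : End.of (biprod.snd ≫ biprod.inr : Y ⊞ Z ⟶ Y ⊞ Z) = 1 - End.of (biprod.fst ≫ biprod.inl) := eq_sub_of_add_eq' htot
  obtain ⟨Φ⟩ := nonempty_end_ringEquiv_corner biprod.inl biprod.fst biprod.inl_fst rfl he
  obtain ⟨Ψ⟩ := nonempty_end_ringEquiv_corner (X := Y ⊞ Z) biprod.inr biprod.snd biprod.inr_snd he' he.one_sub
  haveI := Literature.RingTheory.Idempotents.isSemiperfectRing_of_ringEquiv Φ
  haveI := Literature.RingTheory.Idempotents.isSemiperfectRing_of_ringEquiv Ψ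
  exact Literature.RingTheory.Idempotents.isSemiperfectRing_of_isSemiperfectRing_corner_one_sub he

omit [HasFiniteBiproducts C] in
/-- `End X` is semiperfect for `X ≅ Y ⊞ Z` with `End Y`, `End Z` semiperfect. [cite: AndersonFuller1992, Cor. 27.7] -/
theorem isSemiperfectRing_end_of_iso_biprod [HasBinaryBiproducts C] {Y Z : C} (i : X ≅ Y ⊞ Z) [IsSemiperfectRing (End Y)]
    [IsSemiperfectRing (End Z)] : IsSemiperfectRing (End X) :=
  haveI := isSemiperfectRing_end_biprod Y Z
  isSemiperfectRing_end_of_iso i.symm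

omit [HasFiniteBiproducts C] in
/-- **`End (Y ⊞ Z)` is semiperfect iff `End Y` and `End Z` are.** [cite: AndersonFuller1992, Cor. 27.7] -/
theorem isSemiperfectRing_end_biprod_iff [HasBinaryBiproducts C] (Y Z : C) :
    IsSemiperfectRing (End (Y ⊞ Z)) ↔ IsSemiperfectRing (End Y) ∧ IsSemiperfectRing (End Z) :=
  ⟨fun _ => ⟨isSemiperfectRing_end_of_iso_biprod_left (Iso.refl (Y ⊞ Z)), isSemiperfectRing_end_of_iso_biprod_right (Iso.refl (Y ⊞ Z))⟩,
    fun ⟨_, _⟩ => isSemiperfectRing_end_biprod Y Z⟩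

end Sums

/-! ## §3 Krull–Schmidt objects: local summands, uniqueness, cancellation, multiplicities -/

section KrullSchmidtObjects

variable [HasFiniteBiproducts C] [HasBinaryBiproducts C] [IsIdempotentComplete C] {X : C}

/-- **In a Krull–Schmidt object every indecomposable direct summand has LOCAL endomorphism ring**: if `X ≅ ⨁ⱼ Xⱼ` with local
`End Xⱼ` and `X ≅ ⨁ₖ Yₖ` with the `Yₖ` indecomposable, then every `End Yₖ` is local (Lam (23.5) in the semiperfect ring `End X`).
[cite: Krause2015KS, Thm. 4.2, Cor. 4.4] [cite: Lam2001FirstCourse, §23 Prop. (23.5)] -/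
theorem isLocalRing_end_of_indecomposable_of_iso_biproduct_isLocalRing_end {ι κ : Type} [Fintype ι] [Fintype κ] {Xs : ι → C}
    {Ys : κ → C} (i₁ : X ≅ ⨁ Xs) (h₁ : ∀ j, IsLocalRing (End (Xs j))) (i₂ : X ≅ ⨁ Ys) (h₂ : ∀ k, Indecomposable (Ys k)) (k : κ) :
    IsLocalRing (End (Ys k)) :=
  haveI := isSemiperfectRing_end_of_iso_biproduct_isLocalRing_end i₁ h₁
  isLocalRing_end_of_iso_biproduct_of_indecomposable i₂ h₂ k

/-- A direct summand `Y` (retract) of a Krull–Schmidt object is indecomposable iff `End Y` is local. [cite: Krause2015KS, Cor. 4.4, Thm. 4.2]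
[cite: Lam2001FirstCourse, §23 Prop. (23.5)] -/
theorem indecomposable_iff_isLocalRing_end_of_split_of_iso_biproduct_isLocalRing_end {ι : Type} [Fintype ι] {Xs : ι → C}
    (i : X ≅ ⨁ Xs) (h : ∀ j, IsLocalRing (End (Xs j))) {Y : C} (ι' : Y ⟶ X) (π : X ⟶ Y) (hιπ : ι' ≫ π = 𝟙 Y) :
    Indecomposable Y ↔ IsLocalRing (End Y) :=
  haveI := isSemiperfectRing_end_of_iso_biproduct_isLocalRing_end i h
  haveI := isSemiperfectRing_end_of_split ι' π hιπ
  indecomposable_iff_isLocalRing_end_of_isSemiperfectRing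

variable (X) in
/-- **KRULL–REMAK–SCHMIDT FOR A KRULL–SCHMIDT OBJECT (Krause Thm. 4.2 + Cor. 4.4): if `X` is SOME finite biproduct of objects with local
endomorphism rings, then any two decompositions of `X` into INDECOMPOSABLES have the same length and pairwise isomorphic terms after a
permutation** — no locality hypothesis on the decompositions compared. [cite: Krause2015KS, Thm. 4.2, Cor. 4.4] [cite: Lam2001FirstCourse,
§23 Rem. (23.7), Thm. (23.8)] -/
theorem krullRemakSchmidt_of_iso_biproduct_isLocalRing_end {ι : Type} [Fintype ι] {Xs : ι → C} (i : X ≅ ⨁ Xs)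
    (h : ∀ j, IsLocalRing (End (Xs j))) :
    ∀ {r s : ℕ} {Ys : Fin r → C} {Zs : Fin s → C}, Nonempty (X ≅ ⨁ Ys) → Nonempty (X ≅ ⨁ Zs) →
      (∀ j, Indecomposable (Ys j)) → (∀ k, Indecomposable (Zs k)) →
        r = s ∧ ∃ σ : Fin r ≃ Fin s, ∀ j, Nonempty (Ys j ≅ Zs (σ j)) :=
  haveI := isSemiperfectRing_end_of_iso_biproduct_isLocalRing_end i h
  (krullRemakSchmidt_of_isSemiperfectRing X).2

/-- The bijection form with arbitrary finite index types. [cite: Krause2015KS, Thm. 4.2, Cor. 4.4] -/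
theorem exists_equiv_iso_of_iso_biproduct_of_indecomposable_of_iso_biproduct_isLocalRing_end {ι κ μ : Type} [Fintype ι] [Fintype κ]
    [Fintype μ] [DecidableEq κ] [DecidableEq μ] {Xs : ι → C} {Ys : κ → C} {Zs : μ → C} (i : X ≅ ⨁ Xs)
    (h : ∀ j, IsLocalRing (End (Xs j))) (i₁ : X ≅ ⨁ Ys) (i₂ : X ≅ ⨁ Zs) (h₁ : ∀ k, Indecomposable (Ys k))
    (h₂ : ∀ l, Indecomposable (Zs l)) : ∃ σ : κ ≃ μ, ∀ k, Nonempty (Ys k ≅ Zs (σ k)) :=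
  haveI := isSemiperfectRing_end_of_iso_biproduct_isLocalRing_end i h
  exists_equiv_iso_of_iso_biproduct_of_indecomposable i₁ i₂ h₁ h₂

omit [IsIdempotentComplete C] in
/-- **KRULL–SCHMIDT OBJECTS CANCEL (Evans for a finite sum of local-`End` objects): if `A ≅ ⨁ⱼ Aⱼ` with all `End Aⱼ` local, then
`A ⊞ B ≅ A ⊞ B′` implies `B ≅ B′`** — for arbitrary `B`, `B′`. [cite: Lam2001FirstCourse, §20 Thm. (20.11), Cor. (20.13); §23 Thm. (23.6)]
[cite: Krause2015KS, Cor. 4.3, Cor. 4.4] -/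
theorem nonempty_iso_of_biprod_iso_biprod_of_iso_biproduct_isLocalRing_end {A B B' : C} {ι : Type} [Fintype ι] {As : ι → C}
    (iA : A ≅ ⨁ As) (hA : ∀ j, IsLocalRing (End (As j))) (φ : A ⊞ B ≅ A ⊞ B') : Nonempty (B ≅ B') :=
  haveI := isSemiperfectRing_end_of_iso_biproduct_isLocalRing_end iA hA
  nonempty_iso_of_biprod_iso_biprod_of_isSemiperfectRing_end φ

/-- **POWER CANCELLATION FOR KRULL–SCHMIDT OBJECTS: `X^{⊕α} ≅ Y^{⊕α}` (`α` finite, non-empty) implies `X ≅ Y`** when `X` and `Y` are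
finite sums of local-`End` objects. [cite: Krause2015KS, Thm. 4.2, Cor. 4.4] -/
theorem nonempty_iso_of_biproduct_const_iso_of_iso_biproduct_isLocalRing_end {α : Type} [Finite α] [Nonempty α] {X Y : C}
    {ι κ : Type} [Fintype ι] [Fintype κ] {Xs : ι → C} {Ys : κ → C} (iX : X ≅ ⨁ Xs) (hX : ∀ j, IsLocalRing (End (Xs j)))
    (iY : Y ≅ ⨁ Ys) (hY : ∀ k, IsLocalRing (End (Ys k))) (φ : (⨁ fun _ : α => X) ≅ (⨁ fun _ : α => Y)) : Nonempty (X ≅ Y) :=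
  haveI := isSemiperfectRing_end_of_iso_biproduct_isLocalRing_end iX hX
  haveI := isSemiperfectRing_end_of_iso_biproduct_isLocalRing_end iY hY
  nonempty_iso_of_biproduct_const_iso φ

/-- **`X ≅ Y` iff the indecomposables occur with the same multiplicities**, for objects given with decompositions into indecomposables
with local endomorphism rings (Krause Thm. 4.2 read as a criterion). [cite: Krause2015KS, Thm. 4.2, Cor. 4.4] -/
theorem nonempty_iso_iff_forall_natCard_eq' {X Y : C} {ι κ : Type} [Fintype ι] [Fintype κ] [DecidableEq ι] [DecidableEq κ]
    {Xs : ι → C} {Ys : κ → C} (i₁ : X ≅ ⨁ Xs) (i₂ : Y ≅ ⨁ Ys) (h₁ : ∀ j, IsLocalRing (End (Xs j)))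
    (h₂ : ∀ k, IsLocalRing (End (Ys k))) :
    Nonempty (X ≅ Y) ↔ ∀ V : C, Nat.card {j // Nonempty (Xs j ≅ V)} = Nat.card {k // Nonempty (Ys k ≅ V)} :=
  haveI := isSemiperfectRing_end_of_iso_biproduct_isLocalRing_end i₁ h₁
  haveI := isSemiperfectRing_end_of_iso_biproduct_isLocalRing_end i₂ h₂
  nonempty_iso_iff_forall_natCard_eq i₁ i₂ (fun j => by haveI := h₁ j; exact indecomposable_of_isLocalRing_end)
    fun k => by haveI := h₂ k; exact indecomposable_of_isLocalRing_end

end KrullSchmidtObjects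

end Literature.CategoryTheory.KrullSchmidt
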